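import Summits.CriticalPhenomena.SAWScalingLimit.Theses.SAWConePseudogroup
import Literature.Probability.RandomPlanarGeometry.ConformalRestrictionProofs

/-!
# Birth skeleton (BC3) for crux `PseudogroupDensity` (stmt-CriticalPhenomena-7304),
route `SAWConePseudogroup`, sub-problem `SAWScalingLimit`

Registered line `Lines/birth.lean`.  Three named stubs (the file's only `sorry`s), the kernel-checked
composition with explicit hypotheses `isConformallyCovariant_of_stubSigs : <stub₁-sig> → <stub₂-sig> →
<stub₃-sig> → (crux, unfolded one step)` (real proof), and THE skeleton theorem
`PseudogroupDensity_of : PseudogroupDensity := isConformallyCovariant_of_stubSigs stub₁ stub₂ stub₃`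
concluding the route decl BY NAME (`ledger skeleton check` shape).

The crux says: a chordal family `P` that is covariant under the lattice similarities
`z ↦ r·iᵏ·z + w`, covariant under the single power map `z^{4/3}` on the sector
`S = {z ≠ 0, |arg z| < 3π/4}`, and sequentially continuous along conformal images, is conformally
covariant.  The seam used here is the honest one of the route's proof plan
(Lie–Cartan/Runge density ⟶ transport of laws ⟶ exhaustion):

* `stub_pseudogroupReach` (P-free complex analysis, the Lie–Runge–Euler core): every map `Φ`
  univalent on a neighbourhood of the closure of a Dobrushin domain `D` is a uniform limit on
  `closure D` of WORDS of the pseudogroup generated by the lattice similarities, `p = z^{4/3}` on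
  `S` and `q = w^{3/4}` on the slit plane (`IsWord`), each word valid on a neighbourhood of
  `closure D` (`Reachable D Φ`).
* `stub_wordTransport` (soft measure transport): for `P` with the three crux hypotheses, every
  word transports `P` (induction on the word: similarity covariance, power covariance and its
  inverse form), and transport passes to uniform-on-closure limits of univalent words by the
  sequential continuity; hence `Reachable D Φ → Transports P D Φ` for `Φ` univalent near
  `closure D`.
* `stub_exhaustion` (P-free, Riemann mapping + Carathéodory, both proved in the tree): a conformal
  equivalence `g : D → D'` of Dobrushin domains with boundary values at the marks, and a continuous
  `Φ = g` on `D`, is exhausted by inner Dobrushin domains `Dₙ = Φₙ(D) ⋐ D` (`Φₙ → id` uniformly on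
  `closure D`, `Φₙ` conformal on `D`, injective on `closure D`) with image domains `Eₙ = Φ(Dₙ)`,
  `Φ ∘ Φₙ → Φ` uniformly on `closure D`, and `Φ` is injective on `closure D`.

The composition `isConformallyCovariant_of_stubSigs` is a real proof (no `sorry`): covariance for maps univalent
near the closure from the first two stubs; then for a general `g` the inner laws `P Dₙ → P D` and the
outer laws `P Eₙ → P D'` converge weakly by the sequential-continuity hypothesis, `P Eₙ = Φ_* P Dₙ`
by the univalent case (`Φ` is univalent on `D ⊇ closure Dₙ`), `Φ_*` is weakly continuous
(`CurveClass.continuous_map`), and a finite Borel measure on the metric space `CurveClass ℂ` is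
determined by bounded continuous integrals (`ext_of_forall_integral_eq_of_IsFiniteMeasure`), so
`P D' = Φ_* P D`; the identities `D' = Φ(D)`, `a' = Φ a`, `b' = Φ b` come from `g.bijOn` and the
boundary values of `g` (uniqueness of limits along `𝓝[D] a`, a proper filter since `a ∈ ∂D`).

Disproof used: none on file for this crux (`ledger crux ls`: no Disproof.lean at registration).
-/

noncomputable section

namespace Summit.CriticalPhenomena.SAWScalingLimit.Cruxes.PseudogroupDensity.Birth

open MeasureTheory Filter Topology Set
open Literature.Probability.RandomPlanarGeometry
open Summit.CriticalPhenomena.SAWScalingLimit.Theses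

/-! ### Vocabulary (abbreviations of the crux clauses; no new mathematics) -/

/-- The open sector `S = {z ≠ 0, |arg z| < 3π/4}` on which `z ↦ z^{4/3}` is univalent. -/
def sector : Set ℂ := {z : ℂ | z ≠ 0 ∧ |Complex.arg z| < 3 * Real.pi / 4}

/-- Crux hypothesis 1: covariance under the lattice similarities `z ↦ r·iᵏ·z + w`. -/
def LatticeSimilarityCovariant (P : ChordalFamily) : Prop :=
  ∀ (D : DobrushinDomain) (c : ℂ) (hc : c ≠ 0) (w : ℂ),
    (∃ (r : ℝ) (k : ℕ), 0 < r ∧ c = (r : ℂ) * Complex.I ^ k) →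
      P (D.map (similarity c hc w)) =
        (P D).map (CurveClass.map (similarity c hc w : C(ℂ, ℂ)))

/-- Crux hypothesis 2: covariance under the single power map `z^{4/3}` on sector domains. -/
def PowerMapCovariant (P : ChordalFamily) : Prop :=
  ∀ (D D' : DobrushinDomain) (Φ : C(ℂ, ℂ)), closure D.carrier ⊆ sector →
    Set.EqOn Φ (fun z : ℂ => z ^ ((4 : ℂ) / 3)) sector → D'.carrier = Φ '' D.carrier →
      D'.pt 0 = Φ (D.pt 0) → D'.pt 1 = Φ (D.pt 1) → P D' = (P D).map (CurveClass.map Φ)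

/-- Crux hypothesis 3: sequential continuity of `P` along conformal images. -/
def SeqContinuous (P : ChordalFamily) : Prop :=
  ∀ (D D' : DobrushinDomain) (Dn : ℕ → DobrushinDomain) (Φ : C(ℂ, ℂ)) (Φn : ℕ → C(ℂ, ℂ)),
    TendstoUniformlyOn (fun n => ⇑(Φn n)) Φ atTop (closure D.carrier) →
    DifferentiableOn ℂ Φ D.carrier → Set.InjOn Φ (closure D.carrier) →
    (∀ n, DifferentiableOn ℂ (Φn n) D.carrier ∧ Set.InjOn (Φn n) (closure D.carrier)) →
    D'.carrier = Φ '' D.carrier → D'.pt 0 = Φ (D.pt 0) → D'.pt 1 = Φ (D.pt 1) →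
    (∀ n, (Dn n).carrier = Φn n '' D.carrier ∧ (Dn n).pt 0 = Φn n (D.pt 0) ∧
      (Dn n).pt 1 = Φn n (D.pt 1)) →
    ∀ f : BoundedContinuousFunction (CurveClass ℂ) ℝ,
      Tendsto (fun n => ∫ γ, f γ ∂(P (Dn n))) atTop (𝓝 (∫ γ, f γ ∂(P D')))

/-- `P` transports along `Φ` from `D`: every Dobrushin domain with carrier `Φ(D)` and marks
`Φ a, Φ b` carries the law `Φ_* (P D)`. -/
def Transports (P : ChordalFamily) (D : DobrushinDomain) (Φ : C(ℂ, ℂ)) : Prop :=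
  ∀ D' : DobrushinDomain, D'.carrier = Φ '' D.carrier → D'.pt 0 = Φ (D.pt 0) →
    D'.pt 1 = Φ (D.pt 1) → P D' = (P D).map (CurveClass.map Φ)

/-- WORDS of the pseudogroup generated by the lattice similarities `z ↦ c z + w`
(`c = r·iᵏ`, `r > 0`), the power map `p = z^{4/3}` (a letter allowed only where the current image
of `K` lies in the sector `S`) and its inverse `q = w^{3/4}` (allowed only where the image lies in
the slit plane `p(S) = ℂ ∖ (−∞, 0]`).  `IsWord Ψ K`: `Ψ : ℂ → ℂ` is such a composite, valid on `K`. -/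
inductive IsWord : (ℂ → ℂ) → Set ℂ → Prop
  | refl (K : Set ℂ) : IsWord id K
  | simil {Ψ : ℂ → ℂ} {K : Set ℂ} (c w : ℂ)
      (h : ∃ (r : ℝ) (k : ℕ), 0 < r ∧ c = (r : ℂ) * Complex.I ^ k) :
      IsWord Ψ K → IsWord (fun z => c * Ψ z + w) K
  | pow {Ψ : ℂ → ℂ} {K : Set ℂ} :
      IsWord Ψ K → Ψ '' K ⊆ sector → IsWord (fun z => (Ψ z) ^ ((4 : ℂ) / 3)) K
  | powInv {Ψ : ℂ → ℂ} {K : Set ℂ} :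
      IsWord Ψ K → Ψ '' K ⊆ Complex.slitPlane → IsWord (fun z => (Ψ z) ^ ((3 : ℂ) / 4)) K

/-- `Φ` is REACHABLE on `D`: a uniform limit on `closure D` of plane maps each agreeing, on an open
neighbourhood of `closure D`, with a word of the pseudogroup valid there. -/
def Reachable (D : DobrushinDomain) (Φ : C(ℂ, ℂ)) : Prop :=
  ∃ (V : ℕ → Set ℂ) (Ψ : ℕ → C(ℂ, ℂ)),
    (∀ n, IsOpen (V n) ∧ closure D.carrier ⊆ V n ∧
      ∃ Θ : ℂ → ℂ, IsWord Θ (V n) ∧ Set.EqOn (Ψ n) Θ (V n)) ∧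
    TendstoUniformlyOn (fun n => ⇑(Ψ n)) Φ atTop (closure D.carrier)

/-! ### The stubs -/

/-- **Stub 1 (Lie–Runge–Euler core, P-free).**  The pseudogroup generated by the lattice
similarities and the one power map is `C⁰`-dense, on the closure of any Dobrushin domain, in the
maps univalent near that closure: conjugating translations by `z^{4/3}` puts `w^{1/4}∂` in the
symmetry algebra, brackets and `c`-integration give `(w − c₀)^{-m}∂` for all `m ≥ 1`, Runge with
one pole gives every holomorphic vector field near the continuum, and an Euler/Trotter scheme
along a univalent isotopy realises every univalent map as a limit of words. -/
theorem stub_pseudogroupReach :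
    ∀ (D : DobrushinDomain) (U : Set ℂ) (Φ : C(ℂ, ℂ)), IsOpen U → closure D.carrier ⊆ U →
      DifferentiableOn ℂ Φ U → Set.InjOn Φ U → Reachable D Φ := by
  sorry

/-- **Stub 2 (transport of laws along words and their limits).**  For a chordal `P` with the
three crux hypotheses, every `Φ` univalent near `closure D` that is reachable by words transports
`P` from `D`: each word transports (similarity covariance; power covariance on sector domains and
its inverse form on slit-plane domains; image Dobrushin domains under maps univalent near the
closure exist), and transport passes to the uniform limit by sequential continuity, weak
continuity of `Ψ ↦ Ψ_* (P D)` along `Ψₙ → Φ` on `closure D ⊇` the curves, and uniqueness of weak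
limits. -/
theorem stub_wordTransport :
    ∀ P : ChordalFamily, P.IsChordal → LatticeSimilarityCovariant P → PowerMapCovariant P →
      SeqContinuous P →
      ∀ (D : DobrushinDomain) (U : Set ℂ) (Φ : C(ℂ, ℂ)), IsOpen U → closure D.carrier ⊆ U →
        DifferentiableOn ℂ Φ U → Set.InjOn Φ U → Reachable D Φ → Transports P D Φ := by
  sorry

/-- **Stub 3 (exhaustion, P-free; Riemann mapping + Carathéodory).**  A conformal equivalence
`g : D → D'` of Dobrushin domains with boundary values at the marks, continuously realised by
`Φ = g` on `D`, is exhausted from inside: inner Dobrushin domains `Dₙ = Φₙ(D)` compactly contained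
in `D` with `Φₙ → id` uniformly on `closure D` (`Φₙ = R ∘ (rₙ·) ∘ R⁻¹`, `R` a Riemann map with its
Carathéodory extension, `rₙ ↑ 1`), their images `Eₙ = Φ(Dₙ)` as Dobrushin domains with image
marks, `Φ ∘ Φₙ → Φ` uniformly on `closure D`, and injectivity of `Φ` on `closure D`
(Carathéodory's homeomorphic extension is the unique continuous extension of `g`). -/
theorem stub_exhaustion :
    ∀ (D D' : DobrushinDomain) (g : ConformalEquiv D.carrier D'.carrier) (Φ : C(ℂ, ℂ)),
      g.HasBoundaryValue (D.pt 0) (D'.pt 0) → g.HasBoundaryValue (D.pt 1) (D'.pt 1) →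
      Set.EqOn Φ g D.carrier →
      Set.InjOn Φ (closure D.carrier) ∧
      ∃ (Φn : ℕ → C(ℂ, ℂ)) (Dn En : ℕ → DobrushinDomain),
        TendstoUniformlyOn (fun n => ⇑(Φn n)) (ContinuousMap.id ℂ) atTop (closure D.carrier) ∧
        TendstoUniformlyOn (fun n => ⇑(Φ.comp (Φn n))) Φ atTop (closure D.carrier) ∧
        (∀ n, DifferentiableOn ℂ (Φn n) D.carrier ∧ Set.InjOn (Φn n) (closure D.carrier)) ∧
        (∀ n, closure (Dn n).carrier ⊆ D.carrier) ∧
        (∀ n, (Dn n).carrier = Φn n '' D.carrier ∧ (Dn n).pt 0 = Φn n (D.pt 0) ∧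
          (Dn n).pt 1 = Φn n (D.pt 1)) ∧
        (∀ n, (En n).carrier = Φ '' (Dn n).carrier ∧ (En n).pt 0 = Φ ((Dn n).pt 0) ∧
          (En n).pt 1 = Φ ((Dn n).pt 1)) := by
  sorry

/-! ### The composition (kernel-checked, no `sorry`) -/

/-- **The three stub statements prove the crux** — composition with EXPLICIT hypotheses (the BC3 shape
`stub₁-sig → stub₂-sig → stub₃-sig → crux`), its conclusion written as the one-step unfolding of
`PseudogroupDensity` (the four crux clauses, abbreviated by the vocabulary above, `⟹ IsConformallyCovariant`)
so that `PseudogroupDensity_of` below is the file's ONLY theorem whose head is the crux name (the shape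
`ledger skeleton check` requires).  Real proof, standard axioms only. -/
theorem isConformallyCovariant_of_stubSigs
    (hReach : ∀ (D : DobrushinDomain) (U : Set ℂ) (Φ : C(ℂ, ℂ)), IsOpen U → closure D.carrier ⊆ U →
      DifferentiableOn ℂ Φ U → Set.InjOn Φ U → Reachable D Φ)
    (hTrans : ∀ P : ChordalFamily, P.IsChordal → LatticeSimilarityCovariant P → PowerMapCovariant P →
      SeqContinuous P →
      ∀ (D : DobrushinDomain) (U : Set ℂ) (Φ : C(ℂ, ℂ)), IsOpen U → closure D.carrier ⊆ U →
        DifferentiableOn ℂ Φ U → Set.InjOn Φ U → Reachable D Φ → Transports P D Φ)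
    (hExh : ∀ (D D' : DobrushinDomain) (g : ConformalEquiv D.carrier D'.carrier) (Φ : C(ℂ, ℂ)),
      g.HasBoundaryValue (D.pt 0) (D'.pt 0) → g.HasBoundaryValue (D.pt 1) (D'.pt 1) →
      Set.EqOn Φ g D.carrier →
      Set.InjOn Φ (closure D.carrier) ∧
      ∃ (Φn : ℕ → C(ℂ, ℂ)) (Dn En : ℕ → DobrushinDomain),
        TendstoUniformlyOn (fun n => ⇑(Φn n)) (ContinuousMap.id ℂ) atTop (closure D.carrier) ∧
        TendstoUniformlyOn (fun n => ⇑(Φ.comp (Φn n))) Φ atTop (closure D.carrier) ∧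
        (∀ n, DifferentiableOn ℂ (Φn n) D.carrier ∧ Set.InjOn (Φn n) (closure D.carrier)) ∧
        (∀ n, closure (Dn n).carrier ⊆ D.carrier) ∧
        (∀ n, (Dn n).carrier = Φn n '' D.carrier ∧ (Dn n).pt 0 = Φn n (D.pt 0) ∧
          (Dn n).pt 1 = Φn n (D.pt 1)) ∧
        (∀ n, (En n).carrier = Φ '' (Dn n).carrier ∧ (En n).pt 0 = Φ ((Dn n).pt 0) ∧
          (En n).pt 1 = Φ ((Dn n).pt 1))) :
    ∀ P : ChordalFamily, P.IsChordal → LatticeSimilarityCovariant P → PowerMapCovariant P →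
      SeqContinuous P → P.IsConformallyCovariant := by
  intro P hP hSim hPow hCont
  -- Step 1: covariance for maps univalent on a neighbourhood of the closure (stubs 1 + 2).
  have hcore : ∀ (D : DobrushinDomain) (U : Set ℂ) (Φ : C(ℂ, ℂ)), IsOpen U →
      closure D.carrier ⊆ U → DifferentiableOn ℂ Φ U → Set.InjOn Φ U → Transports P D Φ :=
    fun D U Φ hU hDU hd hi =>
      hTrans P hP hSim hPow hCont D U Φ hU hDU hd hi (hReach D U Φ hU hDU hd hi)
  -- Step 2: a general conformal equivalence with boundary values at the marks (stub 3).
  intro D D' g Φ h0 h1 hEq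
  obtain ⟨hinjΦ, Φn, Dn, En, htu, htu', hreg, hcl, hDn, hEn⟩ := hExh D D' g Φ h0 h1 hEq
  -- bookkeeping: `D' = Φ(D)` with image marks
  have hdiffΦ : DifferentiableOn ℂ Φ D.carrier := g.differentiableOn_coe.congr hEq
  have hinjΦD : Set.InjOn Φ D.carrier := hinjΦ.mono subset_closure
  have hcar : D'.carrier = Φ '' D.carrier := by rw [hEq.image_eq, g.bijOn.image_eq]
  have hmark : ∀ (x y : ℂ), x ∈ frontier D.carrier → g.HasBoundaryValue x y → y = Φ x := by
    intro x y hx hxy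
    haveI : (𝓝[D.carrier] x).NeBot :=
      mem_closure_iff_nhdsWithin_neBot.1 (frontier_subset_closure hx)
    have h₁ : Tendsto Φ (𝓝[D.carrier] x) (𝓝 y) :=
      Tendsto.congr' (hEq.eventuallyEq_nhdsWithin).symm hxy
    have h₂ : Tendsto Φ (𝓝[D.carrier] x) (𝓝 (Φ x)) := Φ.continuous.continuousWithinAt
    exact tendsto_nhds_unique h₁ h₂
  have hpt0 : D'.pt 0 = Φ (D.pt 0) := hmark _ _ (D.pt_mem_frontier 0) h0
  have hpt1 : D'.pt 1 = Φ (D.pt 1) := hmark _ _ (D.pt_mem_frontier 1) h1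
  -- the inner maps send `closure D` into `D`
  have hmaps : ∀ n, Set.MapsTo (Φn n) (closure D.carrier) D.carrier := by
    intro n x hx
    refine hcl n ?_
    rw [(hDn n).1]
    exact image_closure_subset_closure_image (Φn n).continuous ⟨x, hx, rfl⟩
  -- inner laws converge weakly to `P D`
  have hin : ∀ f : BoundedContinuousFunction (CurveClass ℂ) ℝ,
      Tendsto (fun n => ∫ γ, f γ ∂(P (Dn n))) atTop (𝓝 (∫ γ, f γ ∂(P D))) := by
    refine hCont D D Dn (ContinuousMap.id ℂ) Φn htu ?_ ?_ hreg ?_ rfl rfl hDn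
    · exact differentiableOn_id
    · exact Set.injOn_id _
    · simp
  -- outer laws converge weakly to `P D'`
  have hout : ∀ f : BoundedContinuousFunction (CurveClass ℂ) ℝ,
      Tendsto (fun n => ∫ γ, f γ ∂(P (En n))) atTop (𝓝 (∫ γ, f γ ∂(P D'))) := by
    refine hCont D D' En Φ (fun n => Φ.comp (Φn n)) htu' hdiffΦ hinjΦ ?_ hcar hpt0 hpt1 ?_
    · intro n
      exact ⟨hdiffΦ.comp (hreg n).1 ((hmaps n).mono_left subset_closure),
        hinjΦD.comp (hreg n).2 (hmaps n)⟩
    · intro n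
      refine ⟨?_, ?_, ?_⟩
      · rw [(hEn n).1, (hDn n).1, ContinuousMap.coe_comp, Set.image_comp]
      · rw [(hEn n).2.1, (hDn n).2.1]; rfl
      · rw [(hEn n).2.2, (hDn n).2.2]; rfl
  -- identification of the outer laws: `Φ` is univalent on `D ⊇ closure Dₙ`
  have hid : ∀ n, P (En n) = (P (Dn n)).map (CurveClass.map Φ) := fun n =>
    hcore (Dn n) D.carrier Φ D.isOpen (hcl n) hdiffΦ hinjΦD (En n) (hEn n).1 (hEn n).2.1
      (hEn n).2.2
  -- conclusion: finite Borel measures on a metric space are determined by bounded continuous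
  -- integrals, and weak limits are unique
  haveI : IsProbabilityMeasure (P D) := (hP D).1
  haveI : IsProbabilityMeasure (P D') := (hP D').1
  have hΦm : Measurable (CurveClass.map Φ) := CurveClass.measurable_map Φ
  haveI : IsProbabilityMeasure ((P D).map (CurveClass.map Φ)) :=
    Measure.isProbabilityMeasure_map hΦm.aemeasurable
  refine ext_of_forall_integral_eq_of_IsFiniteMeasure fun f => ?_
  rw [integral_map hΦm.aemeasurable f.continuous.aestronglyMeasurable]
  set f' : BoundedContinuousFunction (CurveClass ℂ) ℝ :=
    f.compContinuous ⟨CurveClass.map Φ, CurveClass.continuous_map Φ⟩ with hf'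
  have h₁ := hout f
  have h₂ := hin f'
  have h₃ : (fun n => ∫ γ, f γ ∂(P (En n))) = fun n => ∫ γ, f' γ ∂(P (Dn n)) := by
    funext n
    rw [hid n, integral_map hΦm.aemeasurable f.continuous.aestronglyMeasurable]
    simp [hf']
  rw [h₃] at h₁
  have key := tendsto_nhds_unique h₁ h₂
  simpa [hf'] using key


/-- **THE SKELETON THEOREM.**  The crux
`Summit.CriticalPhenomena.SAWScalingLimit.Theses.SAWConePseudogroup.PseudogroupDensity`, concluded BY
NAME from the three DECLARED stubs (the only `sorry`s of the file) through the sorry-free composition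
`isConformallyCovariant_of_stubSigs` (the vocabulary defs unfold to the crux's clauses verbatim). -/
theorem PseudogroupDensity_of : SAWConePseudogroup.PseudogroupDensity :=
  isConformallyCovariant_of_stubSigs stub_pseudogroupReach stub_wordTransport stub_exhaustion

end Summit.CriticalPhenomena.SAWScalingLimit.Cruxes.PseudogroupDensity.Birth

end
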